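import Summits.ResolutionOfSingularities.ResolutionOfSingularities.Theorems.WeightedInvariantELadderOneStage
import Summits.ResolutionOfSingularities.ResolutionOfSingularities.Theorems.WeightedInvariantIotaMaxStratum
import Summits.ResolutionOfSingularities.ResolutionOfSingularities.Theorems.WeightedInvariantHypersurfaceCentreAssemblyPointDict
import HarnessLib

/-!
# Rung `e = 1` of the door: the termination measure of a stage (maximal singular points, `mu`)

Route `ResolutionOfSingularities/WeightedInvariant`, door crux `HypersurfaceCentreConstruction`
(stmt-ResolutionOfSingularities-19897), e-ladder line of `res-L1-w43-stub-10` (skeleton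
`D/res-D-pv-025/E1Skeleton.lean`, DEFS module `Theorems/WeightedInvariantELadderOneStage.lean`).
Helper file for the stub `stub_e1_inv_succ` (the successor stage satisfies the invariant and its measure
drops): the BOOKKEEPING half, i.e. everything about `Stage.maxSing` / `Stage.mu` that does not look at the
cobordant blow-up.

* maximal points of a closed subset of a Noetherian sober `T₀` space (no definition is introduced; the
  predicate «`η ∈ C` and every `y ∈ C` specialising to `η` equals `η`» is spelled out): they are generic
  points of members of any finite irreducible closed decomposition (`exists_isGenericPoint_of_maximal`), hence
  FINITE (`finite_setOf_maximal`), and every point of `C` specialises from one of them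
  (`exists_maximal_mem_closure`);
* for a stage `S`: `maxSing_finite`, `exists_mem_maxSing_of_mem_singImage`, `maxSing_nonempty_iff`
  (`↔ ¬ IsRegular S.X`); at a point of `singImage` the order of `ker i` is `≥ 1` and `< ⊤`
  (`one_le_idealOrder_of_mem_singImage`, `idealOrder_lt_top_of_mem_singImage`: the germ is non-zero since the
  ambient stalk is regular and the quotient is not); `le_mu_of_mem_maxSing`, `exists_mu_eq` (the supremum is
  attained), `one_le_mu`, `mu_lt_top`, `mu_eq_zero_of_isRegular`;
* **the drop reduction** `mu_lt_mu_of_forall_exists`: if every maximal singular point of `S'` has order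
  strictly below the order of SOME maximal singular point of a singular stage `S`, then `S'.mu < S.mu` — the
  last line of any proof of `stub_e1_inv_succ`.

Nothing here is a claim about Hironaka's problem; AI-written, weaker than expert review.
-/

noncomputable section

set_option linter.dupNamespace false -- mandated namespace of this single-conjunct summit

open CategoryTheory AlgebraicGeometry TopologicalSpace IsLocalRing Topology
open Literature.AlgebraicGeometry.Resolution
open Summit.ResolutionOfSingularities.ResolutionOfSingularities.Theorems
open Summit.ResolutionOfSingularities.ResolutionOfSingularities.Cruxes.HypersurfaceCentreConstruction.LocalEngine
  (mem_support_of_mem_singImage mem_singImage_iff_not_isRegularLocalRing_quotient)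

namespace Summit.ResolutionOfSingularities.ResolutionOfSingularities.Theorems.ELadderOne

/-! ## Maximal points of a closed subset of a Noetherian sober space -/

section MaxPoints

variable {α : Type*} [TopologicalSpace α]

/-- A maximal point of a closed set `C = ⋃₀ S` (finite union of irreducible closed sets) is the generic point
of some member of `S`: it lies in some `t ∈ S`, whose generic point specialises to it inside `C`. [folklore] -/
theorem exists_isGenericPoint_of_maximal [QuasiSober α] {C : Set α} {S : Set (Set α)}
    (hSc : ∀ t ∈ S, IsClosed t) (hSi : ∀ t ∈ S, IsIrreducible t) (hCS : C = ⋃₀ S)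
    {η : α} (hη : η ∈ C) (hmax : ∀ y ∈ C, η ∈ closure ({y} : Set α) → y = η) :
    ∃ t ∈ S, IsGenericPoint η t := by
  obtain ⟨t, htS, hηt⟩ : ∃ t ∈ S, η ∈ t := by
    rw [hCS] at hη
    exact Set.mem_sUnion.mp hη
  refine ⟨t, htS, ?_⟩
  have hgen : IsGenericPoint (hSi t htS).genericPoint t :=
    (hSi t htS).isGenericPoint_genericPoint (hSc t htS)
  have hζC : (hSi t htS).genericPoint ∈ C := by
    rw [hCS]
    exact Set.mem_sUnion.mpr ⟨t, htS, hgen.mem⟩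
  have hηcl : η ∈ closure ({(hSi t htS).genericPoint} : Set α) := by
    rw [hgen.def]
    exact hηt
  rw [← hmax _ hζC hηcl]
  exact hgen

/-- **The maximal points of a closed subset of a Noetherian sober `T₀` space form a finite set** (they are
generic points of irreducible components). [folklore] -/
theorem finite_setOf_maximal [NoetherianSpace α] [QuasiSober α] [T0Space α] {C : Set α}
    (hC : IsClosed C) :
    {η | η ∈ C ∧ ∀ y ∈ C, η ∈ closure ({y} : Set α) → y = η}.Finite := by
  obtain ⟨S, hSf, hSc, hSi, hCS⟩ := NoetherianSpace.exists_finite_set_isClosed_irreducible hC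
  refine Set.Finite.of_finite_image (f := fun η : α => closure ({η} : Set α)) ?_ ?_
  · refine hSf.subset ?_
    rintro _ ⟨η, ⟨hη, hmax⟩, rfl⟩
    obtain ⟨t, htS, hgen⟩ := exists_isGenericPoint_of_maximal hSc hSi hCS hη hmax
    change closure ({η} : Set α) ∈ S
    rw [hgen.def]
    exact htS
  · intro a _ b _ hab
    exact (inseparable_iff_closure_eq.mpr hab).eq

/-- **Every point of a closed subset of a Noetherian sober `T₀` space specialises from a maximal point**
(the generic point of a maximal member of a finite irreducible closed decomposition containing it).
[folklore] -/
theorem exists_maximal_mem_closure [NoetherianSpace α] [QuasiSober α] [T0Space α] {C : Set α}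
    (hC : IsClosed C) {y : α} (hy : y ∈ C) :
    ∃ η, (η ∈ C ∧ ∀ y' ∈ C, η ∈ closure ({y'} : Set α) → y' = η) ∧ y ∈ closure ({η} : Set α) := by
  obtain ⟨S, hSf, hSc, hSi, hCS⟩ := NoetherianSpace.exists_finite_set_isClosed_irreducible hC
  obtain ⟨t, htS, hyt⟩ : ∃ t ∈ S, y ∈ t := by
    rw [hCS] at hy
    exact Set.mem_sUnion.mp hy
  obtain ⟨t', htt', ht'max⟩ := hSf.exists_le_maximal htS
  have ht'S : t' ∈ S := ht'max.1
  have hgen : IsGenericPoint (hSi t' ht'S).genericPoint t' :=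
    (hSi t' ht'S).isGenericPoint_genericPoint (hSc t' ht'S)
  refine ⟨(hSi t' ht'S).genericPoint, ⟨?_, ?_⟩, ?_⟩
  · rw [hCS]
    exact Set.mem_sUnion.mpr ⟨t', ht'S, hgen.mem⟩
  · intro y' hy' hζy'
    obtain ⟨t'', ht''S, hy't''⟩ : ∃ t'' ∈ S, y' ∈ t'' := by
      rw [hCS] at hy'
      exact Set.mem_sUnion.mp hy'
    have h1 : closure ({y'} : Set α) ⊆ t'' :=
      closure_minimal (Set.singleton_subset_iff.mpr hy't'') (hSc t'' ht''S)
    have h2 : t' ⊆ closure ({y'} : Set α) := by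
      rw [← hgen.def]
      exact closure_minimal (Set.singleton_subset_iff.mpr hζy') isClosed_closure
    have h4 : t'' ⊆ t' := ht'max.2 ht''S (h2.trans h1)
    have hcl : closure ({y'} : Set α) = closure {(hSi t' ht'S).genericPoint} := by
      rw [hgen.def]
      exact le_antisymm (h1.trans h4) h2
    exact (inseparable_iff_closure_eq.mpr hcl).eq
  · rw [hgen.def]
    exact htt' hyt

end MaxPoints

/-! ## The maximal singular points of a stage -/

namespace Stage

variable {k : Type} [Field k] (S : Stage k)

/-- The underlying space of the ambient of a stage is Noetherian (smooth quasi-compact over a field). [folklore] -/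
theorem noetherianSpace : NoetherianSpace S.Y := noetherianSpace_of_smooth_quasiCompact S.f

/-- Maximal singular points are singular image points. [folklore] -/
theorem maxSing_subset_singImage : S.maxSing ⊆ singImage S.i.ker := fun _ h => h.1

/-- **`maxSing` is finite**: the image of the non-regular locus is closed in the Noetherian sober ambient, and
its maximal points are generic points of irreducible components. [folklore] -/
theorem maxSing_finite : S.maxSing.Finite := by
  haveI := S.noetherianSpace
  exact finite_setOf_maximal (isClosed_singImage S.f S.i.ker)

/-- **Every singular image point specialises from a maximal one.** [folklore] -/
theorem exists_mem_maxSing_of_mem_singImage {y : S.Y} (hy : y ∈ singImage S.i.ker) :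
    ∃ η ∈ S.maxSing, y ∈ closure ({η} : Set S.Y) := by
  haveI := S.noetherianSpace
  obtain ⟨η, hη, hyη⟩ := exists_maximal_mem_closure (isClosed_singImage S.f S.i.ker) hy
  exact ⟨η, hη, hyη⟩

/-- `X` is regular iff the image subscheme `V(ker i)` is (the closed immersion `i` induces the isomorphism
`i.toImage`, so the stalks correspond); route-independent copy of
`Theorems.isRegular_iff_isRegular_image` (…DatumToEmbeddedRegular, which sits in the Theses cone). [folklore] -/
theorem isRegular_iff_isRegular_image : Scheme.IsRegular S.X ↔ Scheme.IsRegular S.i.image := by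
  have e : ∀ x : S.X, IsRegularLocalRing (S.i.image.presheaf.stalk (S.i.toImage x)) ↔
      IsRegularLocalRing (S.X.presheaf.stalk x) := fun x =>
    ⟨fun _ => IsRegularLocalRing.of_ringEquiv (asIso (S.i.toImage.stalkMap x)).commRingCatIsoToRingEquiv,
      fun _ => IsRegularLocalRing.of_ringEquiv (asIso (S.i.toImage.stalkMap x)).commRingCatIsoToRingEquiv.symm⟩
  constructor
  · intro h x'
    obtain ⟨x, rfl⟩ := S.i.toImage.surjective x'
    exact (e x).mpr (h x)
  · intro h x
    exact (e x).mp (h (S.i.toImage x))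

/-- `maxSing` is non-empty exactly when the hypersurface is singular. [folklore] -/
theorem maxSing_nonempty_iff : S.maxSing.Nonempty ↔ ¬ Scheme.IsRegular S.X := by
  rw [S.isRegular_iff_isRegular_image, ← singImage_nonempty_iff S.i.ker]
  constructor
  · rintro ⟨η, hη⟩
    exact ⟨η, hη.1⟩
  · rintro ⟨y, hy⟩
    obtain ⟨η, hη, -⟩ := S.exists_mem_maxSing_of_mem_singImage hy
    exact ⟨η, hη⟩

/-- `maxSing = ∅` for a regular stage. [folklore] -/
theorem maxSing_eq_empty_of_isRegular (h : Scheme.IsRegular S.X) : S.maxSing = ∅ := by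
  rw [← Set.not_nonempty_iff_eq_empty, S.maxSing_nonempty_iff, not_not]
  exact h

/-! ## Orders at singular image points -/

/-- At a point of `singImage (ker i)` the order of `ker i` is at least `1` (the point is in the support).
[folklore] -/
theorem one_le_idealOrder_of_mem_singImage {y : S.Y} (hy : y ∈ singImage S.i.ker) :
    1 ≤ idealOrder S.i.ker y :=
  (one_le_idealOrder_iff _ _).mpr (mem_support_of_mem_singImage _ hy)

/-- At a point of `singImage (ker i)` the germ of `ker i` is non-zero: the ambient stalk is regular (smooth over
a field) while its quotient by the germ is not. [folklore] -/
theorem stalkIdeal_ne_bot_of_mem_singImage {y : S.Y} (hy : y ∈ singImage S.i.ker) :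
    stalkIdeal S.i.ker y ≠ ⊥ := by
  intro hbot
  haveI : IsLocallyNoetherian S.Y := LocallyOfFiniteType.isLocallyNoetherian S.f
  have hY : Scheme.IsRegular S.Y := Scheme.IsRegular.of_smooth S.f (Scheme.isRegular_Spec (.of k))
  haveI : IsRegularLocalRing (S.Y.presheaf.stalk y) := hY y
  refine (mem_singImage_iff_not_isRegularLocalRing_quotient S.i.ker
    (mem_support_of_mem_singImage _ hy)).mp hy ?_
  rw [hbot]
  exact IsRegularLocalRing.of_ringEquiv (RingEquiv.quotientBot (S.Y.presheaf.stalk y)).symm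

/-- At a point of `singImage (ker i)` the order of `ker i` is finite (Krull's intersection theorem in the
Noetherian stalk: a non-zero ideal is not in every power of `𝔪`). [folklore] -/
theorem idealOrder_lt_top_of_mem_singImage {y : S.Y} (hy : y ∈ singImage S.i.ker) :
    idealOrder S.i.ker y < ⊤ := by
  haveI : IsLocallyNoetherian S.Y := LocallyOfFiniteType.isLocallyNoetherian S.f
  by_contra h
  rw [not_lt, top_le_iff] at h
  apply S.stalkIdeal_ne_bot_of_mem_singImage hy
  rw [eq_bot_iff, ← Ideal.iInf_pow_eq_bot_of_isLocalRing (I := maximalIdeal (S.Y.presheaf.stalk y))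
    (maximalIdeal.isMaximal _).ne_top]
  refine le_iInf fun r => (le_idealOrder_iff S.i.ker y r).mp ?_
  rw [h]
  exact le_top

/-! ## The measure `mu` -/

/-- The order at a maximal singular point is at most `mu`. [folklore] -/
theorem le_mu_of_mem_maxSing {η : S.Y} (hη : η ∈ S.maxSing) : idealOrder S.i.ker η ≤ S.mu :=
  le_iSup₂ (f := fun (η : S.Y) (_ : η ∈ S.maxSing) => idealOrder S.i.ker η) η hη

/-- **`mu` is attained** at some maximal singular point of a singular stage (`maxSing` is finite and non-empty).
[folklore] -/
theorem exists_mu_eq (h : ¬ Scheme.IsRegular S.X) : ∃ η ∈ S.maxSing, S.mu = idealOrder S.i.ker η := by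
  obtain ⟨η, hη, hmax⟩ :=
    Set.exists_max_image S.maxSing (idealOrder S.i.ker) S.maxSing_finite (S.maxSing_nonempty_iff.mpr h)
  exact ⟨η, hη, le_antisymm (iSup₂_le hmax) (S.le_mu_of_mem_maxSing hη)⟩

/-- `mu = 0` for a regular stage (empty supremum). [folklore] -/
theorem mu_eq_zero_of_isRegular (h : Scheme.IsRegular S.X) : S.mu = 0 := by
  refine le_antisymm (iSup₂_le fun η hη => ?_) bot_le
  rw [S.maxSing_eq_empty_of_isRegular h] at hη
  exact absurd hη (Set.notMem_empty η)

/-- `1 ≤ mu` for a singular stage. [folklore] -/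
theorem one_le_mu (h : ¬ Scheme.IsRegular S.X) : 1 ≤ S.mu := by
  obtain ⟨η, hη⟩ := S.maxSing_nonempty_iff.mpr h
  exact (S.one_le_idealOrder_of_mem_singImage hη.1).trans (S.le_mu_of_mem_maxSing hη)

/-- `mu` is finite. [folklore] -/
theorem mu_lt_top : S.mu < ⊤ := by
  by_cases h : Scheme.IsRegular S.X
  · rw [S.mu_eq_zero_of_isRegular h]
    exact WithTop.coe_lt_top (0 : ℕ)
  · obtain ⟨η, hη, hmu⟩ := S.exists_mu_eq h
    rw [hmu]
    exact S.idealOrder_lt_top_of_mem_singImage hη.1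

/-- `mu` is positive exactly when the stage is singular. [folklore] -/
theorem mu_pos_iff : 0 < S.mu ↔ ¬ Scheme.IsRegular S.X := by
  constructor
  · intro h hreg
    rw [S.mu_eq_zero_of_isRegular hreg] at h
    exact lt_irrefl _ h
  · intro h
    exact lt_of_lt_of_le zero_lt_one (S.one_le_mu h)

/-- **The drop reduction.**  If every maximal singular point of `S'` has order strictly below the order of some
maximal singular point of the singular stage `S`, then `S'.mu < S.mu` (`maxSing S'` is finite, so its supremum
is attained or empty). [folklore] -/
theorem mu_lt_mu_of_forall_exists (S S' : Stage k) (hS : ¬ Scheme.IsRegular S.X)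
    (h : ∀ η' ∈ S'.maxSing, ∃ η ∈ S.maxSing, idealOrder S'.i.ker η' < idealOrder S.i.ker η) :
    S'.mu < S.mu := by
  by_cases h' : Scheme.IsRegular S'.X
  · rw [S'.mu_eq_zero_of_isRegular h']
    exact S.mu_pos_iff.mpr hS
  · obtain ⟨η', hη', hmu'⟩ := S'.exists_mu_eq h'
    obtain ⟨η, hη, hlt⟩ := h η' hη'
    rw [hmu']
    exact lt_of_lt_of_le hlt (S.le_mu_of_mem_maxSing hη)

/-- The drop reduction, pointwise-bound form: if `S'.mu` is bounded by the order at each of its maximal singular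
points being `<` a fixed maximal order of `S`. Convenience restatement with the old point given as a function.
[folklore] -/
theorem mu_lt_mu_of_maps_to (S S' : Stage k) (hS : ¬ Scheme.IsRegular S.X) (φ : S'.Y → S.Y)
    (hφ : ∀ η' ∈ S'.maxSing, φ η' ∈ S.maxSing)
    (hlt : ∀ η' ∈ S'.maxSing, idealOrder S'.i.ker η' < idealOrder S.i.ker (φ η')) :
    S'.mu < S.mu :=
  mu_lt_mu_of_forall_exists S S' hS fun η' hη' => ⟨φ η', hφ η' hη', hlt η' hη'⟩

end Stage

end Summit.ResolutionOfSingularities.ResolutionOfSingularities.Theorems.ELadderOne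

end
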